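import Mathlib.Data.Countable.Defs
import Mathlib.Data.Finite.Defs
import Mathlib.Logic.Equiv.Defs
import Literature.Dynamics.Tilings.WangTiles
import HarnessLib

/-!
# Wang tiles: reindexing the tiles, recolouring the edges, reduction to colour tables

Companion of `Literature/Dynamics/Tilings/WangTiles.lean`. Whether a tile set tiles the plane
or a torus depends only on the tile set up to renaming: reindexing the tiles along a bijection
and recolouring the edges along an injection change none of `TilesPlane`, `TilesTorus n`,
`IsAperiodic` (Jeandel–Vanier: "`C` can be thought as a set of colors, patterns, symbols or
integers", §1.1). Consequently every tile set with finitely many tiles and countably many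
colours is, for these purposes, a colour table `τ : Fin t → ℕ × ℕ × ℕ × ℕ`
(`WangTileSet.ofNESW`, the presentation inlined in route PneNP/AperiodicTorus):
`exists_ofNESW_iff`, `IsAperiodic.exists_ofNESW`.

## Lean contents (namespace `Literature.Dynamics.Tilings.WangTileSet`)

* `reindex T e` (tiles `κ`, tile `k` is the tile `e k` of `T`), `map T g` (recolour along
  `g : C → C'`).
* `tilesPlane_reindex_iff`, `tilesTorus_reindex_iff`, `isAperiodic_reindex_iff` (along an
  equivalence `e : κ ≃ ι`); `tilesPlane_map_iff`, `tilesTorus_map_iff`, `isAperiodic_map_iff`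
  (along an injective recolouring).
* `exists_ofNESW_iff` — `[Finite ι] [Countable C]`: some table `τ : Fin t → ℕ⁴` has
  `(ofNESW τ).TilesPlane ↔ T.TilesPlane` and `(ofNESW τ).TilesTorus n ↔ T.TilesTorus n` for all
  `n`; `IsAperiodic.exists_ofNESW`.

## References

* E. Jeandel, P. Vanier, *The undecidability of the Domino Problem*, LNM 2273 (2020), §1.1
  (Definitions 1–2), §1.2.
-/

namespace Literature.Dynamics.Tilings

namespace WangTileSet

universe u u' v w

variable {ι : Type u} {κ : Type u'} {C : Type v} {C' : Type w}

/-! ### Reindexing the tiles -/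

/-- **Reindexing**: the tile set with tiles `κ` whose tile `k` is the tile `e k` of `T` (for an
equivalence `e` a renaming of the tiles; in general it also allows repeating or dropping tiles).
[cite: JeandelVanier2020, §1.1 Definition 1] -/
def reindex (T : WangTileSet ι C) (e : κ → ι) : WangTileSet κ C where
  north k := T.north (e k)
  east k := T.east (e k)
  south k := T.south (e k)
  west k := T.west (e k)

/-- A plane tiling by the reindexed set is, read through `e`, a plane tiling by `T`.
[folklore] -/
theorem IsPlaneTiling.of_reindex {T : WangTileSet ι C} {e : κ → ι} {f : ℤ → ℤ → κ}
    (h : (T.reindex e).IsPlaneTiling f) : T.IsPlaneTiling fun i j => e (f i j) :=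
  h

/-- A plane tiling by `T` is, read through `e.symm`, a plane tiling by the set reindexed along
an equivalence `e`. [folklore] -/
theorem IsPlaneTiling.reindex_symm {T : WangTileSet ι C} (e : κ ≃ ι) {f : ℤ → ℤ → ι}
    (h : T.IsPlaneTiling f) : (T.reindex e).IsPlaneTiling fun i j => e.symm (f i j) := by
  intro i j
  simpa only [reindex, Equiv.apply_symm_apply] using h i j

/-- Reindexing along an equivalence does not change whether the plane is tiled. [folklore] -/
theorem tilesPlane_reindex_iff (T : WangTileSet ι C) (e : κ ≃ ι) :
    (T.reindex e).TilesPlane ↔ T.TilesPlane :=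
  ⟨fun ⟨_, hf⟩ => ⟨_, hf.of_reindex⟩, fun ⟨_, hf⟩ => ⟨_, hf.reindex_symm e⟩⟩

/-- A torus tiling by the reindexed set is, read through `e`, a torus tiling by `T`.
[folklore] -/
theorem IsTorusTiling.of_reindex {T : WangTileSet ι C} {e : κ → ι} {n : ℕ}
    {f : Fin n → Fin n → κ} (h : (T.reindex e).IsTorusTiling n f) :
    T.IsTorusTiling n fun i j => e (f i j) :=
  h

/-- A torus tiling by `T` is, read through `e.symm`, a torus tiling by the set reindexed along
an equivalence `e`. [folklore] -/
theorem IsTorusTiling.reindex_symm {T : WangTileSet ι C} (e : κ ≃ ι) {n : ℕ}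
    {f : Fin n → Fin n → ι} (h : T.IsTorusTiling n f) :
    (T.reindex e).IsTorusTiling n fun i j => e.symm (f i j) := by
  intro i j
  simpa only [reindex, Equiv.apply_symm_apply] using h i j

/-- Reindexing along an equivalence does not change which tori are tiled. [folklore] -/
theorem tilesTorus_reindex_iff (T : WangTileSet ι C) (e : κ ≃ ι) (n : ℕ) :
    (T.reindex e).TilesTorus n ↔ T.TilesTorus n :=
  ⟨fun ⟨_, hf⟩ => ⟨_, hf.of_reindex⟩, fun ⟨_, hf⟩ => ⟨_, hf.reindex_symm e⟩⟩

/-- Reindexing along an equivalence does not change aperiodicity. [folklore] -/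
theorem isAperiodic_reindex_iff (T : WangTileSet ι C) (e : κ ≃ ι) :
    (T.reindex e).IsAperiodic ↔ T.IsAperiodic := by
  unfold IsAperiodic
  rw [tilesPlane_reindex_iff]
  simp only [tilesTorus_reindex_iff]

/-! ### Recolouring the edges -/

/-- **Recolouring**: the tile set with the same tiles whose edge colours are transported along
`g : C → C'` ("`C` can be thought as a set of colors, patterns, symbols or integers").
[cite: JeandelVanier2020, §1.1 Definition 1] -/
def map (T : WangTileSet ι C) (g : C → C') : WangTileSet ι C' where
  north s := g (T.north s)
  east s := g (T.east s)
  south s := g (T.south s)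
  west s := g (T.west s)

/-- Recolouring preserves plane tilings. [folklore] -/
theorem IsPlaneTiling.map {T : WangTileSet ι C} {f : ℤ → ℤ → ι} (h : T.IsPlaneTiling f)
    (g : C → C') : (T.map g).IsPlaneTiling f :=
  fun i j => ⟨congrArg g (h i j).1, congrArg g (h i j).2⟩

/-- An INJECTIVE recolouring reflects plane tilings. [folklore] -/
theorem IsPlaneTiling.of_map {T : WangTileSet ι C} {g : C → C'} (hg : Function.Injective g)
    {f : ℤ → ℤ → ι} (h : (T.map g).IsPlaneTiling f) : T.IsPlaneTiling f :=
  fun i j => ⟨hg (h i j).1, hg (h i j).2⟩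

/-- An injective recolouring does not change whether the plane is tiled. [folklore] -/
theorem tilesPlane_map_iff (T : WangTileSet ι C) {g : C → C'} (hg : Function.Injective g) :
    (T.map g).TilesPlane ↔ T.TilesPlane :=
  ⟨fun ⟨f, hf⟩ => ⟨f, hf.of_map hg⟩, fun ⟨f, hf⟩ => ⟨f, hf.map g⟩⟩

/-- Recolouring preserves torus tilings. [folklore] -/
theorem IsTorusTiling.map {T : WangTileSet ι C} {n : ℕ} {f : Fin n → Fin n → ι}
    (h : T.IsTorusTiling n f) (g : C → C') : (T.map g).IsTorusTiling n f :=
  fun i j => ⟨congrArg g (h i j).1, congrArg g (h i j).2⟩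

/-- An injective recolouring reflects torus tilings. [folklore] -/
theorem IsTorusTiling.of_map {T : WangTileSet ι C} {g : C → C'} (hg : Function.Injective g)
    {n : ℕ} {f : Fin n → Fin n → ι} (h : (T.map g).IsTorusTiling n f) : T.IsTorusTiling n f :=
  fun i j => ⟨hg (h i j).1, hg (h i j).2⟩

/-- An injective recolouring does not change which tori are tiled. [folklore] -/
theorem tilesTorus_map_iff (T : WangTileSet ι C) {g : C → C'} (hg : Function.Injective g)
    (n : ℕ) : (T.map g).TilesTorus n ↔ T.TilesTorus n :=
  ⟨fun ⟨f, hf⟩ => ⟨f, hf.of_map hg⟩, fun ⟨f, hf⟩ => ⟨f, hf.map g⟩⟩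

/-- An injective recolouring does not change aperiodicity. [folklore] -/
theorem isAperiodic_map_iff (T : WangTileSet ι C) {g : C → C'} (hg : Function.Injective g) :
    (T.map g).IsAperiodic ↔ T.IsAperiodic := by
  unfold IsAperiodic
  rw [tilesPlane_map_iff T hg]
  simp only [tilesTorus_map_iff T hg]

/-! ### Reduction to colour tables `Fin t → ℕ × ℕ × ℕ × ℕ` -/

/-- **Without loss of generality, a colour table.** A tile set with finitely many tiles and
countably many colours tiles the plane, resp. the `n × n` torus, iff some (explicitly: any
reindexing along `ι ≃ Fin t` of an injective recolouring into `ℕ`) colour table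
`τ : Fin t → ℕ × ℕ × ℕ × ℕ` does. [folklore] -/
theorem exists_ofNESW_iff [Finite ι] [Countable C] (T : WangTileSet ι C) :
    ∃ (t : ℕ) (τ : Fin t → ℕ × ℕ × ℕ × ℕ),
      ((ofNESW τ).TilesPlane ↔ T.TilesPlane) ∧ ∀ n : ℕ, (ofNESW τ).TilesTorus n ↔ T.TilesTorus n := by
  obtain ⟨t, ⟨e⟩⟩ := Finite.exists_equiv_fin ι
  obtain ⟨g, hg⟩ := Countable.exists_injective_nat C
  refine ⟨t, ((T.map g).reindex e.symm).toNESW, ?_, fun n => ?_⟩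
  · rw [ofNESW_toNESW, tilesPlane_reindex_iff, tilesPlane_map_iff T hg]
  · rw [ofNESW_toNESW, tilesTorus_reindex_iff, tilesTorus_map_iff T hg]

/-- An aperiodic tile set with finitely many tiles and countably many colours yields an
aperiodic colour table `τ : Fin t → ℕ × ℕ × ℕ × ℕ` (same number of tiles). [folklore] -/
theorem IsAperiodic.exists_ofNESW [Finite ι] [Countable C] {T : WangTileSet ι C}
    (h : T.IsAperiodic) : ∃ (t : ℕ) (τ : Fin t → ℕ × ℕ × ℕ × ℕ), (ofNESW τ).IsAperiodic := by
  obtain ⟨t, τ, hplane, htorus⟩ := T.exists_ofNESW_iff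
  exact ⟨t, τ, hplane.2 h.1, fun n hn hT => h.2 n hn ((htorus n).1 hT)⟩

end WangTileSet

end Literature.Dynamics.Tilings
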